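import Literature.Probability.Percolation.ArmSeparationIntFenceBound
import Literature.Probability.Percolation.ArmSeparationReroute
import HarnessLib

/-!
# Rerouting an arm along the exploration sequence at an INTERNAL extremity (inner side `1`)

Topic: Probability / Percolation; family `crit-perc`. The deterministic conclusion of Kesten's
separation step for ONE arm leaving the inner side `1` of `∂Λ_m` (Nolin 2008, §4.4, proof of
Thm. 11 [arXiv 0711.4948: Thm. 10], "2. Internal extremities", and the end of the proof of
Lemma 15 [arXiv Lemma 14]: "it has to cross at least one of the `c_v` (by maximality of `𝒞`) …
it is connected to the small extension `c̃_{v₁}`"), the internal twin of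
`ArmSeparationReroute.lean` (`trap_reroute`, external extremities behind side `0`), assembled from

* `TriHalfAnnulus.lean` — the inner half-annulus `HalfAnnulus.intDom m` as a `JDomain`;
* `TriLowestCrossing.lean` — the exploration sequence and its maximality
  `JDomain.exists_lowestSeq_inter_nonempty`;
* `ArmSeparationIntFenceBound.lean` — the per-term success `IntFenceOK` and the failure event
  `IntSeqFail` (whose probability is bounded there), for tips away from the ends of the side;
* `ArmSeparationFrame.lean` — frames (`triFrameAt`, `FrameData.exists_mem_K`), used here around the
  two ENDS of the side: a closed frame around an end of the side `1` forbids open crossings of the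
  half-annulus with tips near that end (`HalfAnnulus.le_tip_of_compl_mem_triFrameAt`,
  `HalfAnnulus.tip_le_of_compl_mem_triFrameAt`) — this is how the corners of `∂Λ_m` are handled.

`HalfAnnulus.int_reroute_of_region`: if the exploration sequence of `intDom m` in `ω` stops before
`T`, no term `u < T` with a middle tip fails (`¬ IntSeqFail m T k₀ K R₀ ω`), and the closed sites of
`ω` contain frames around both ends of the side at scales `R ≥ R₀` with `4R < m`, then every open
`𝕋`-path inside a region `A` of sites of norm `≥ m` containing the half-annulus `HA(m)` (e.g. the
annulus `{m ≤ |v| ≤ N}`, `2m ≤ N`: `int_reroute`; or such an annulus together with outer free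
spaces) from a site `y` of the tip arc `IsIntJ m` to a site `b` beyond the half-annulus (`b₀ < 0` or
`|b| > 2m`) is REROUTED: from `b` there is an open path of `A`, continued through the fence zone
`intFrameZone m z k` of some middle tip `z` at some scale `k = k₀ · 32^j`, `j < K`, to a site `mm`
of an open vertical crossing of the box `[m-2k, m-k] × [z₁+k, z₁+2k]` inside `Λ̊_m`, the tip being
protected from above at scale `8k` (`IntTipOK`); and an open path of `A` from `b` to `z`. The closed
arm is the same statement for `ωᶜ` (`int_reroute_closed`).

## References

* P. Nolin, *Near-critical percolation in two dimensions*, Electron. J. Probab. 13 (2008), §4.4,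
  proof of Thm. 11 (internal extremities) and of Lemma 15 [arXiv 0711.4948: Thm. 10, Lemma 14]. [Nolin2008]
* H. Kesten, *Scaling relations for 2D-percolation*, Comm. Math. Phys. 109 (1987), Lemma 2. [Kesten1987]

Tree: `IntFenceOK`, `IntSeqFail`, `IntMidTip` (`ArmSeparationIntFenceBound.lean`); `intFrameZone`
(`ArmSeparationIntFrame.lean`); `triAnnSet` (`ArmSeparationReroute.lean`); `triFrameAt`,
`nonempty_frameData`, `FrameData.exists_mem_K`, `FrameData.K_subset` (`ArmSeparationFrame.lean`);
`HalfAnnulus.intDom`, `intDom_cutProp`, `mem_intDom_F/J`, `haSet`, `IsIntJ` (`TriHalfAnnulus.lean`);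
`JDomain.exists_crossing_subset`, `exists_lowestSeq_inter_nonempty`, `lowestSeq_eq_none_of_le`,
`isCrossing_of_lowestSeq` (`TriLowestCrossing.lean`); `PathIn.last_exit`, `PathIn.exists_support`
(`SitePaths.lean`, `TriRSWChaining.lean`); `triNorm_le_iff_lin`, `le_triNorm_iff_lin` (`ArmEventsAPriori.lean`).
-/

noncomputable section

open Set

namespace Literature.Probability.Percolation

open LatticeModels

namespace HalfAnnulus

variable {m : ℕ}

/-! ### Closed frames around the ends of the side keep open tips away from the ends -/

/-- The start of a crossing of `intDom m` lies outside the box of half-width `2R` about either end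
of the side `1` when `4R < m`. [folklore] -/
theorem start_far_from_ends {R : ℕ} (hRm : 4 * R < m) {f : Site 2} (hf : f ∈ (intDom m).F) (e : ℤ)
    (he : -(m : ℤ) ≤ e ∧ e ≤ 0) :
    f 0 ≤ (m : ℤ) - 2 * R ∨ (m : ℤ) + 2 * R ≤ f 0 ∨ f 1 ≤ e - 2 * R ∨ e + 2 * R ≤ f 1 := by
  have hRm' : 4 * (R : ℤ) < m := by exact_mod_cast hRm
  obtain ⟨hfD, hfF⟩ := mem_intDom_F.1 hf
  have hf0 := (mem_haFin.1 hfD).1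
  rcases hfF with h | h
  · left; omega
  · have hge := le_triNorm_iff_lin.1 h.ge
    omega

/-- **A closed frame around the lower end `(m, -m)` of the side keeps open tips above it**: if
`c` is a crossing of `intDom m` open in `ω` and the closed sites of `ω` contain the frame at scale
`R` about `(m, -m)` (`1 ≤ R`, `4R < m`), then the tip satisfies `z₁ ≥ -m + R` — otherwise the open
connected `c`, from its start (far from the corner) to its tip (inside the inner box), would meet
the closed frame (`FrameData.exists_mem_K`). [cite: Nolin2008, §4.4 Thm. 11 (proof, internal extremities) (arXiv 0711.4948: Thm. 10)] -/
theorem le_tip_of_compl_mem_triFrameAt {R : ℕ} (hR : 1 ≤ R) (hRm : 4 * R < m) {c : Finset (Site 2)} {z : Site 2}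
    (hc : (intDom m).IsCrossing c z) {ω : SiteConfig (Site 2)} (hcω : (↑c : Set (Site 2)) ⊆ ω)
    (hfr : ωᶜ ∈ triFrameAt ![(m : ℤ), -(m : ℤ)] R) : -(m : ℤ) + R ≤ z 1 := by
  by_contra hlt
  rw [not_le] at hlt
  obtain ⟨hz0, hz1, hz2⟩ := (mem_intDom_J.1 hc.tip_mem_J).2
  obtain ⟨F⟩ := nonempty_frameData hfr
  obtain ⟨f, hfc, hfF⟩ := hc.exists_start
  have ht := start_far_from_ends hRm hfF (-(m : ℤ)) ⟨le_rfl, by omega⟩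
  obtain ⟨v, hvc, hvK⟩ := F.exists_mem_K hR (s := z) (t := f)
    (by simp only [Matrix.cons_val_zero, Matrix.cons_val_one, Matrix.cons_val_fin_one]; omega)
    (by simp only [Matrix.cons_val_zero, Matrix.cons_val_one, Matrix.cons_val_fin_one]; omega)
    (hc.conn z hc.tip_mem f hfc)
  exact F.K_subset hvK (hcω hvc)

/-- **A closed frame around the upper end `(m, 0)` of the side keeps open tips below it**:
`z₁ ≤ -R` (same argument). [cite: Nolin2008, §4.4 Thm. 11 (proof, internal extremities) (arXiv 0711.4948: Thm. 10)] -/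
theorem tip_le_of_compl_mem_triFrameAt {R : ℕ} (hR : 1 ≤ R) (hRm : 4 * R < m) {c : Finset (Site 2)} {z : Site 2}
    (hc : (intDom m).IsCrossing c z) {ω : SiteConfig (Site 2)} (hcω : (↑c : Set (Site 2)) ⊆ ω)
    (hfr : ωᶜ ∈ triFrameAt ![(m : ℤ), 0] R) : z 1 ≤ -(R : ℤ) := by
  by_contra hlt
  rw [not_le] at hlt
  obtain ⟨hz0, hz1, hz2⟩ := (mem_intDom_J.1 hc.tip_mem_J).2
  obtain ⟨F⟩ := nonempty_frameData hfr
  obtain ⟨f, hfc, hfF⟩ := hc.exists_start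
  have ht := start_far_from_ends hRm hfF 0 ⟨by omega, le_rfl⟩
  obtain ⟨v, hvc, hvK⟩ := F.exists_mem_K hR (s := z) (t := f)
    (by simp only [Matrix.cons_val_zero, Matrix.cons_val_one, Matrix.cons_val_fin_one]; omega)
    (by simp only [Matrix.cons_val_zero, Matrix.cons_val_one, Matrix.cons_val_fin_one]; omega)
    (hc.conn z hc.tip_mem f hfc)
  exact F.K_subset hvK (hcω hvc)

/-- **Corner guards give middle tips**: closed frames at scales `R₁, R₂ ≥ R₀` (`4Rᵢ < m`) around the
two ends of the side force `IntMidTip m R₀ z` for every crossing of `intDom m` open in `ω`. [cite: Nolin2008, §4.4 Thm. 11 (proof, internal extremities) (arXiv 0711.4948: Thm. 10)] -/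
theorem intMidTip_of_guards {R₀ R₁ R₂ : ℕ} (h₁ : R₀ ≤ R₁) (h₁m : 4 * R₁ < m) (h₂ : R₀ ≤ R₂) (h₂m : 4 * R₂ < m)
    (hR₀ : 1 ≤ R₀) {c : Finset (Site 2)} {z : Site 2} (hc : (intDom m).IsCrossing c z) {ω : SiteConfig (Site 2)}
    (hcω : (↑c : Set (Site 2)) ⊆ ω) (hdn : ωᶜ ∈ triFrameAt ![(m : ℤ), -(m : ℤ)] R₁)
    (hup : ωᶜ ∈ triFrameAt ![(m : ℤ), 0] R₂) : IntMidTip m R₀ z := by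
  have hlo := le_tip_of_compl_mem_triFrameAt (by omega) h₁m hc hcω hdn
  have hhi := tip_le_of_compl_mem_triFrameAt (by omega) h₂m hc hcω hup
  have e₁ : (R₀ : ℤ) ≤ R₁ := by exact_mod_cast h₁
  have e₂ : (R₀ : ℤ) ≤ R₂ := by exact_mod_cast h₂
  exact ⟨by linarith, by linarith⟩

/-! ### Rerouting -/

/-- **The fenced, protected tip at an internal extremity** at scale `k` in `ω`: an open vertical
crossing of the box `[z₀-2k, z₀-k] × [z₁+k, z₁+2k]` (inside `Λ̊_m`) through `mm`, and protection
from above at scale `8k` (no closed path of the half-annulus from a top-type boundary site of the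
inner box of half-width `8k` about `z` to outside the box of half-width `16k`) — the unpacked
success event `IntFenceOK` without the crossing. [cite: Nolin2008, §4.2 Def. 7 (free spaces, internal boundary) (arXiv 0711.4948)] -/
def IntTipOK (m : ℕ) (z : Site 2) (k : ℕ) (ω : SiteConfig (Site 2)) (mm : Site 2) : Prop :=
  OpenVCrossThrough (triStrip (z 0 - 2 * k) (z 1 + k) k k) (z 1 + k) (z 1 + 2 * k) ω mm ∧
    ∀ q t : Site 2, q ∈ (intDom m).Tp ∪ (intDom m).Jabove z →
      (z 0 - 8 * k ≤ q 0 ∧ q 0 ≤ z 0 + 8 * k ∧ z 1 - 8 * k ≤ q 1 ∧ q 1 ≤ z 1 + 8 * k) →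
      (t 0 ≤ z 0 - 16 * k ∨ z 0 + 16 * k ≤ t 0 ∨ t 1 ≤ z 1 - 16 * k ∨ z 1 + 16 * k ≤ t 1) →
      ¬ PathIn triGraph (haSet m ∩ ωᶜ) q t

/-- The sites of a path inside the half-annulus, as a `Finset` of `haFin m`. [folklore] -/
theorem exists_finset_coe_eq_of_subset_haSet {S : Set (Site 2)} (hS : S ⊆ haSet m) :
    ∃ S' : Finset (Site 2), S' ⊆ haFin m ∧ (↑S' : Set (Site 2)) = S := by
  classical
  refine ⟨(haFin m).filter fun v => v ∈ S, Finset.filter_subset _ _, ?_⟩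
  ext v
  simp only [Finset.coe_filter, Set.mem_setOf_eq]
  exact ⟨fun h => h.2, fun h => ⟨by rw [← Finset.mem_coe, coe_haFin]; exact hS h, h⟩⟩

/-- The half-annulus lies in the annulus `{m ≤ |v| ≤ N}` for `2m ≤ N`. [folklore] -/
theorem haSet_subset_triAnnSet {N : ℕ} (hN : 2 * m ≤ N) : haSet m ⊆ triAnnSet m N := by
  intro v hv
  rw [mem_haSet] at hv
  rw [mem_triAnnSet]
  have : (2 * m : ℕ) ≤ (N : ℤ) := by exact_mod_cast hN
  push_cast at this
  exact ⟨hv.2.1, hv.2.2.trans this⟩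

/-- **Rerouting an open arm leaving the inner side `1`, general region** (Nolin 2008, proof of
Thm. 11, internal extremities, with the end of the proof of Lemma 15). Let `m ≥ 5` and let `A` be a
set of sites of norm `≥ m` containing the half-annulus `HA(m)`. Suppose that in `ω` the exploration
sequence of `intDom m` has stopped at `T`, that no term `u < T` with a middle tip fails
(`¬ IntSeqFail m T k₀ K R₀ ω`, `R₀ ≥ 1`), and that the closed sites contain frames at scales
`R₁, R₂ ≥ R₀`, `4Rᵢ < m`, about the two ends `(m, -m)`, `(m, 0)` of the side. Then for every open
path inside `A` from a site `y` of the tip arc (`IsIntJ m y`) to a site `b` beyond the half-annulus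
(`b₀ < 0` or `|b| > 2m`) there are a middle tip `z` (`IsIntJ`, `IntMidTip m R₀`), a scale
`k = k₀ · 32^j`, `j < K`, and a site `mm` with `IntTipOK m z k ω mm`, an open path of `A` continued
through `intFrameZone m z k` from `b` to `mm`, and an open path of `A` from `b` to `z`: the segment
of the path after its last visit beyond `HA(m)` is an open path of the half-annulus from a start
site to the tip arc, contains an open crossing (`JDomain.exists_crossing_subset`), which meets a
term of the exploration sequence (maximality), of index `< T`, with a middle tip (corner guards),
hence fenced; follow the path, the crossing and the fence connection. [cite: Nolin2008, §4.4 Thm. 11 (proof, internal extremities) and Lemma 15 (proof) (arXiv 0711.4948: Thm. 10, Lemma 14)] -/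
theorem int_reroute_of_region {T k₀ K R₀ R₁ R₂ : ℕ} (hm : 5 ≤ m) {A : Set (Site 2)}
    (hA : ∀ v ∈ A, (m : ℤ) ≤ triNorm v) (hHA : haSet m ⊆ A) (hR₀ : 1 ≤ R₀)
    (h₁ : R₀ ≤ R₁) (h₁m : 4 * R₁ < m) (h₂ : R₀ ≤ R₂) (h₂m : 4 * R₂ < m) {ω : SiteConfig (Site 2)}
    (hT : (intDom m).lowestSeq ω T = none) (hOK : ¬ IntSeqFail m T k₀ K R₀ ω)
    (hdn : ωᶜ ∈ triFrameAt ![(m : ℤ), -(m : ℤ)] R₁) (hup : ωᶜ ∈ triFrameAt ![(m : ℤ), 0] R₂)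
    {y b : Site 2} (hy : IsIntJ m y) (hb : b 0 < 0 ∨ 2 * (m : ℤ) < triNorm b)
    (hpath : PathIn triGraph (A ∩ ω) y b) :
    ∃ z : Site 2, IsIntJ m z ∧ IntMidTip m R₀ z ∧ ∃ j < K, ∃ mm : Site 2, IntTipOK m z (trapScale k₀ j) ω mm ∧
      PathIn triGraph ((A ∪ intFrameZone m z (trapScale k₀ j)) ∩ ω) b mm ∧
      PathIn triGraph (A ∩ ω) b z := by
  classical
  have hcut := intDom_cutProp hm
  have hm' : (5 : ℤ) ≤ m := by exact_mod_cast hm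
  obtain ⟨hy0, hy1, hy2⟩ := hy
  -- a tight support of the whole path (from `y`)
  obtain ⟨S₀, hS₀, hp₀, ht₀⟩ := hpath.exists_support
  -- the initial segment before the first visit beyond the half-annulus, seen from `b`: last exit
  set C : Set (Site 2) := {v | v 0 < 0 ∨ 2 * (m : ℤ) < triNorm v} with hC
  have hbC : b ∈ C := hb
  have hyC : y ∉ C := by
    simp only [hC, Set.mem_setOf_eq, not_or, not_lt]
    exact ⟨by omega, triNorm_le_iff_lin.2 (by omega)⟩
  obtain ⟨p, q, hpC, -, hqC, hpq, hσ⟩ := hp₀.symm.last_exit (C := C) hbC hyC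
  have hpC' : p 0 < 0 ∨ 2 * (m : ℤ) < triNorm p := hpC
  simp only [hC, Set.mem_setOf_eq, not_or, not_lt] at hqC
  -- its sites are open sites of the half-annulus
  have hσH : ∀ v ∈ S₀ \ C, v ∈ haSet m ∩ ω := by
    rintro v ⟨hv, hvC⟩
    have hvC' : ¬ (v 0 < 0 ∨ 2 * (m : ℤ) < triNorm v) := hvC
    obtain ⟨h, hvω⟩ := hS₀ hv
    exact ⟨mem_haSet.2 ⟨by omega, hA v h, by omega⟩, hvω⟩
  obtain ⟨S₁, hS₁, hp₁, ht₁⟩ := hσ.exists_support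
  have hS₁H : S₁ ⊆ haSet m := fun v hv => (hσH v (hS₁ hv)).1
  obtain ⟨S₁', hS₁'D, hcoe⟩ := exists_finset_coe_eq_of_subset_haSet hS₁H
  -- the first site `q` is a start site: `q₀ = 0` or `|q| = 2m`
  have hqH : q ∈ haFin m := by rw [← Finset.mem_coe, coe_haFin]; exact hS₁H hp₁.left_mem
  have hqF : q ∈ (intDom m).F := by
    refine mem_intDom_F.2 ⟨hqH, ?_⟩
    have h0 := (triGraph_adj_coord hpq 0)
    have hn := triNorm_le_triNorm_add_one_of_adj' hpq
    rcases hpC' with h | h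
    · left; omega
    · right; omega
  have hyJ : y ∈ (intDom m).J := by
    refine mem_intDom_J.2 ⟨?_, hy0, hy1, hy2⟩
    rw [← Finset.mem_coe, coe_haFin]
    exact hS₁H hp₁.right_mem
  -- an open crossing inside the segment, and a term of the exploration sequence meeting it
  obtain ⟨c', w, hc', hc'S⟩ := (intDom m).exists_crossing_subset (S := S₁') hS₁'D hqF hyJ (hcoe ▸ hp₁)
  have hc'S₁ : (↑c' : Set (Site 2)) ⊆ S₁ := hcoe ▸ Finset.coe_subset.2 hc'S
  have hc'ω : (↑c' : Set (Site 2)) ⊆ ω := fun v hv => (hσH v (hS₁ (hc'S₁ hv))).2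
  obtain ⟨u, c, z, hu, x, hx⟩ := JDomain.exists_lowestSeq_inter_nonempty hcut hc' hc'ω
  rw [Finset.mem_inter] at hx
  obtain ⟨hc, hcω⟩ := JDomain.isCrossing_of_lowestSeq hu
  -- the sequence has stopped at `T`, so `u < T`; the tip is a middle tip (corner guards); no failure
  have huT : u < T := by
    by_contra h
    rw [JDomain.lowestSeq_eq_none_of_le hT (not_lt.1 h)] at hu
    exact absurd hu (by simp)
  have hmid : IntMidTip m R₀ z := intMidTip_of_guards h₁ h₁m h₂ h₂m hR₀ hc hcω hdn hup
  have hok : ∃ j < K, IntFenceOK m c z (trapScale k₀ j) ω := by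
    by_contra hno
    exact hOK ⟨u, huT, c, z, hu, hmid, fun j hj hj' => hno ⟨j, hj, hj'⟩⟩
  obtain ⟨j, hj, ⟨mm, hmmV, s, hsc, hsm⟩, hprot⟩ := hok
  refine ⟨z, (mem_intDom_J.1 hc.tip_mem_J).2, hmid, j, hj, mm, ⟨hmmV, hprot⟩, ?_⟩
  -- assemble `b → q → x → s → mm`
  have hcH : (↑c : Set (Site 2)) ⊆ haSet m := by
    intro v hv; rw [← coe_haFin]; exact Finset.mem_coe.2 (hc.subset (Finset.mem_coe.1 hv))
  set A' : Set (Site 2) := (A ∪ intFrameZone m z (trapScale k₀ j)) ∩ ω with hA'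
  have hS₀A : S₀ ⊆ A' := fun v hv => ⟨Or.inl (hS₀ hv).1, (hS₀ hv).2⟩
  have hS₁A : S₁ ⊆ A' := fun v hv => hS₀A (hS₁ hv).1
  have hcA : (↑c : Set (Site 2)) ⊆ A' := fun v hv => ⟨Or.inl (hHA (hcH hv)), hcω hv⟩
  have hbS₀ : b ∈ S₀ := hp₀.right_mem
  have hqS₀ : q ∈ S₀ := (hS₁ hp₁.left_mem).1
  have h1 : PathIn triGraph S₀ b q := (ht₀ b hbS₀).symm.trans (ht₀ q hqS₀)
  have h2 : PathIn triGraph S₁ q x := ht₁ x (hc'S₁ (Finset.mem_coe.2 hx.1))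
  have h3 : PathIn triGraph A' x s := (hc.conn x hx.2 s hsc).mono hcA
  have h4 : PathIn triGraph A' s mm := hsm.mono fun v hv => ⟨Or.inr hv.1, hv.2⟩
  refine ⟨(((h1.mono hS₀A).trans (h2.mono hS₁A)).trans h3).trans h4, ?_⟩
  -- and `b → q → x → z` inside `A`
  have hcB : (↑c : Set (Site 2)) ⊆ A ∩ ω := fun v hv => ⟨hHA (hcH hv), hcω hv⟩
  exact ((h1.mono hS₀).trans (h2.mono fun v hv => hS₀ (hS₁ hv).1)).trans ((hc.conn x hx.2 z hc.tip_mem).mono hcB)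

/-- **Rerouting an open arm leaving the inner side `1`** in the annulus `{m ≤ |v| ≤ N}`, `2m ≤ N`
(`int_reroute_of_region` for `A = triAnnSet m N`). [cite: Nolin2008, §4.4 Thm. 11 (proof, internal extremities) and Lemma 15 (proof) (arXiv 0711.4948: Thm. 10, Lemma 14)] -/
theorem int_reroute {N T k₀ K R₀ R₁ R₂ : ℕ} (hm : 5 ≤ m) (hN : 2 * m ≤ N) (hR₀ : 1 ≤ R₀)
    (h₁ : R₀ ≤ R₁) (h₁m : 4 * R₁ < m) (h₂ : R₀ ≤ R₂) (h₂m : 4 * R₂ < m) {ω : SiteConfig (Site 2)}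
    (hT : (intDom m).lowestSeq ω T = none) (hOK : ¬ IntSeqFail m T k₀ K R₀ ω)
    (hdn : ωᶜ ∈ triFrameAt ![(m : ℤ), -(m : ℤ)] R₁) (hup : ωᶜ ∈ triFrameAt ![(m : ℤ), 0] R₂)
    {y b : Site 2} (hy : IsIntJ m y) (hb : b 0 < 0 ∨ 2 * (m : ℤ) < triNorm b)
    (hpath : PathIn triGraph (triAnnSet m N ∩ ω) y b) :
    ∃ z : Site 2, IsIntJ m z ∧ IntMidTip m R₀ z ∧ ∃ j < K, ∃ mm : Site 2, IntTipOK m z (trapScale k₀ j) ω mm ∧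
      PathIn triGraph ((triAnnSet m N ∪ intFrameZone m z (trapScale k₀ j)) ∩ ω) b mm ∧
      PathIn triGraph (triAnnSet m N ∩ ω) b z :=
  int_reroute_of_region hm (fun _ hv => (mem_triAnnSet.1 hv).1) (haSet_subset_triAnnSet hN) hR₀ h₁ h₁m h₂ h₂m
    hT hOK hdn hup hy hb hpath

/-- **Rerouting a closed arm leaving the inner side `1`**: `int_reroute` for the complementary
configuration `ωᶜ` (closed arm, open corner guards, failure events of `ωᶜ`). [cite: Nolin2008, §4.4 Thm. 11 (proof, internal extremities) (arXiv 0711.4948: Thm. 10, Lemma 14)] -/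
theorem int_reroute_closed {N T k₀ K R₀ R₁ R₂ : ℕ} (hm : 5 ≤ m) (hN : 2 * m ≤ N) (hR₀ : 1 ≤ R₀)
    (h₁ : R₀ ≤ R₁) (h₁m : 4 * R₁ < m) (h₂ : R₀ ≤ R₂) (h₂m : 4 * R₂ < m) {ω : SiteConfig (Site 2)}
    (hT : (intDom m).lowestSeq ωᶜ T = none) (hOK : ¬ IntSeqFail m T k₀ K R₀ ωᶜ)
    (hdn : ω ∈ triFrameAt ![(m : ℤ), -(m : ℤ)] R₁) (hup : ω ∈ triFrameAt ![(m : ℤ), 0] R₂)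
    {y b : Site 2} (hy : IsIntJ m y) (hb : b 0 < 0 ∨ 2 * (m : ℤ) < triNorm b)
    (hpath : PathIn triGraph (triAnnSet m N ∩ ωᶜ) y b) :
    ∃ z : Site 2, IsIntJ m z ∧ IntMidTip m R₀ z ∧ ∃ j < K, ∃ mm : Site 2, IntTipOK m z (trapScale k₀ j) ωᶜ mm ∧
      PathIn triGraph ((triAnnSet m N ∪ intFrameZone m z (trapScale k₀ j)) ∩ ωᶜ) b mm ∧
      PathIn triGraph (triAnnSet m N ∩ ωᶜ) b z :=
  int_reroute hm hN hR₀ h₁ h₁m h₂ h₂m hT hOK (by rwa [compl_compl]) (by rwa [compl_compl]) hy hb hpath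

end HalfAnnulus

end Literature.Probability.Percolation
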